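import Literature.NumberTheory.Weil1965.AdelicFibreMeasures
import Mathlib.Analysis.Normed.Group.Tannery
import HarnessLib

/-!
# Schwartz–Bruhat cut-offs on `𝔸_F^ι`: a positive functional continuous along cut-offs IS its measure

Topic `NumberTheory/Weil1965`; namespace `Literature.NumberTheory.Weil1965` (sequel of `AdelicFibreMeasures`).
KERNEL MATHEMATICS ONLY: proved theorems, no definition, no named fact, no `sorry`.

The Radon measure `ν_S = schwartzBruhatMeasure S hS` of a positive functional `S` on the real Schwartz–Bruhat
functions `𝒮_ℝ(X)`, `X = 𝔸_F^ι`, reproduces `S` on compactly supported elements and satisfies `∫ Ψ dν_S ≤ S Ψ`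
(`AdelicFibreMeasures`); equality for every `Ψ` — i.e. `S` "is" the TEMPERED measure `ν_S` — is Weil's
"convergence uniforme sur toute partie compacte de `𝒮(X)`" [Weil1965, Chap. I n° 2 Lemmes 2, 3 and 5; Chap. IV
n° 41 p. 59]. This file isolates the one place where that uniformity enters:

* §1 `exists_isCompact_isOpen_exhaustion` — `(𝔸_F^∞)^ι` is an increasing union of compact open sets; with the smooth
  bumps on `(F ⊗ ℝ)^ι` this yields TENSOR CUT-OFFS `c_n = β_n ⊗ 𝟙_{U_n} ∈ 𝒮_ℝ(X)`, `0 ≤ c_n ≤ 1`, compactly supported,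
  `c_n → 1` pointwise (`exists_tensor_cutoff`): the family along which consumers verify uniform bounds.
* §2 GENERIC: if `S(Ψ c_n) → S(Ψ)` along compactly supported cut-offs `0 ≤ c_n ≤ 1` in `𝒮_ℝ(X)`, then
  `∫ Ψ dν_S = S Ψ` for every `Ψ ≥ 0` (`integral_schwartzBruhatMeasure_eq_of_tendsto_cutoff`); and two linear functionals
  on `𝒮_ℝ(X)` which are continuous along the cut-offs and agree on compactly supported functions are EQUAL
  (`linearMap_eq_of_tendsto_cutoff`) — the form in which a Siegel–Weil identity of MEASURES (`ν_E = κ ν_I`) becomes the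
  identity of FUNCTIONALS `E = κ I` on all of `𝒮(X)`.
* §3 WEIL'S `E_X`: continuity of `E_X` along the cut-offs follows from a UNIFORM height-type majorant
  `‖F*_{Ψ c_n}(ξ)‖ ≤ m(ξ)`, `Σ m < ∞` (Tannery's theorem; `tendsto_adelicSiegelFunctional_cutoff`) — the family-uniform
  form of Weil's condition (B) [Weil1965, Chap. I n° 2 Prop. 2 (B₁)].

## References

* A. Weil, *Sur la formule de Siegel dans la théorie des groupes classiques*, Acta Math. 113 (1965): Chap. I n° 2,
  Lemmes 2–5 and Prop. 2, pp. 7–12; Chap. IV n° 41 p. 59 [Weil1965].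
-/

noncomputable section

open MeasureTheory NumberField NumberField.InfinitePlace NumberField.mixedEmbedding IsDedekindDomain Filter
  Topology Set Metric Literature.NumberTheory.Automorphic Literature.MeasureTheory.RieszRepresentation
open scoped Classical

namespace Literature.NumberTheory.Weil1965

variable (F : Type) [Field F] [NumberField F] (ι : Type) [Fintype ι]

/-! ### §1 Compact open exhaustions and tensor cut-offs -/

omit [Fintype ι] in
/-- `(𝔸_F^∞)^ι` is totally disconnected. [folklore] -/
private theorem totallyDisconnectedSpace_piFin : TotallyDisconnectedSpace (ι → FiniteAdeleRing (𝓞 F) F) := by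
  haveI := totallyDisconnectedSpace_finiteAdeleRing (E := F)
  infer_instance

omit [Fintype ι] in
/-- `(𝔸_F^∞)^ι` is Hausdorff. [folklore] -/
private theorem t2Space_piFin : T2Space (ι → FiniteAdeleRing (𝓞 F) F) := by
  haveI : T2Space (FiniteAdeleRing (𝓞 F) F) := inferInstanceAs <| T2Space
    (RestrictedProduct (fun w : HeightOneSpectrum (𝓞 F) => w.adicCompletion F)
      (fun w => (w.adicCompletionIntegers F : Set (w.adicCompletion F))) Filter.cofinite)
  infer_instance

/-- **A compact set of `(𝔸_F^∞)^ι` lies in a compact OPEN set** (finite cover by compact open neighbourhoods — the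
clopen basis of a totally disconnected locally compact space). [cite: Weil1965, Chap. I n° 2, Lemme 5, p. 10] -/
theorem exists_isCompact_isOpen_superset {K : Set (ι → FiniteAdeleRing (𝓞 F) F)} (hK : IsCompact K) :
    ∃ U : Set (ι → FiniteAdeleRing (𝓞 F) F), IsCompact U ∧ IsOpen U ∧ K ⊆ U := by
  haveI := t2Space_piFin F ι
  haveI := totallyDisconnectedSpace_piFin F ι
  haveI := locallyCompactSpace_finiteAdeleRing' (K := F)
  have hloc : ∀ x : ι → FiniteAdeleRing (𝓞 F) F, ∃ C : Set (ι → FiniteAdeleRing (𝓞 F) F),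
      IsCompact C ∧ IsOpen C ∧ x ∈ C := fun x => by
    obtain ⟨N, hNc, hNx⟩ := exists_compact_mem_nhds x
    obtain ⟨C, hC, hxC, hCN⟩ :=
      (loc_compact_Haus_tot_disc_of_zero_dim (H := ι → FiniteAdeleRing (𝓞 F) F)).exists_subset_of_mem_open
        (mem_interior_iff_mem_nhds.mpr hNx) isOpen_interior
    exact ⟨C, hNc.of_isClosed_subset hC.isClosed (hCN.trans interior_subset), hC.isOpen, hxC⟩
  choose C hCc hCo hxC using hloc
  obtain ⟨t, ht⟩ := hK.elim_finite_subcover C hCo fun x hx => mem_iUnion.mpr ⟨x, hxC x⟩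
  exact ⟨⋃ x ∈ t, C x, t.isCompact_biUnion fun x _ => hCc x, isOpen_biUnion fun x _ => hCo x, ht⟩

/-- **`(𝔸_F^∞)^ι` is an increasing union of compact open sets.** [cite: Weil1965, Chap. I n° 2, Lemme 5, p. 10] -/
theorem exists_isCompact_isOpen_exhaustion :
    ∃ U : ℕ → Set (ι → FiniteAdeleRing (𝓞 F) F), (∀ n, IsCompact (U n)) ∧ (∀ n, IsOpen (U n)) ∧ Monotone U ∧
      ∀ z, ∃ n, z ∈ U n := by
  haveI := t2Space_piFin F ι
  haveI := locallyCompactSpace_finiteAdeleRing' (K := F)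
  haveI := secondCountableTopology_finiteAdeleRing (K := F)
  -- compact open supersets of the compact covering, made monotone by finite unions
  choose V hVc hVo hKV using fun n => exists_isCompact_isOpen_superset F ι (isCompact_compactCovering
    (ι → FiniteAdeleRing (𝓞 F) F) n)
  refine ⟨fun n => ⋃ k ∈ Finset.range (n + 1), V k, fun n => (Finset.range (n + 1)).isCompact_biUnion
    fun k _ => hVc k, fun n => isOpen_biUnion fun k _ => hVo k, fun m n hmn => ?_, fun z => ?_⟩
  · exact biUnion_subset_biUnion_left fun k hk => Finset.mem_range.mpr
      ((Finset.mem_range.mp hk).trans_le (Nat.succ_le_succ hmn))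
  · obtain ⟨n, hn⟩ := exists_mem_compactCovering z
    exact ⟨n, mem_biUnion (Finset.mem_range.mpr (Nat.lt_succ_self n)) (hKV n hn)⟩

/-- **Tensor cut-offs in `𝒮_ℝ(𝔸_F^ι)`**: for a smooth bump `β` on `(F ⊗ ℝ)^ι` and a compact open `U ⊆ (𝔸_F^∞)^ι`, the
function `c = β ⊗ 𝟙_U` is a real Schwartz–Bruhat function with `0 ≤ c ≤ 1`, compact support, `c = 1` on the box
`closedBall(β.c, β.rIn) × U`. [cite: Weil1965, Chap. I n° 2, Lemme 5, p. 10] -/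
theorem tensor_cutoff_spec {c₀ : ι → mixedSpace F} (β : ContDiffBump c₀)
    {U : Set (ι → FiniteAdeleRing (𝓞 F) F)} (hUc : IsCompact U) (hUo : IsOpen U) :
    (fun v => β (piArch F ι v) * U.indicator 1 (piFinite F ι v)) ∈ piSchwartzBruhatReal F ι ∧
      (∀ v, (fun v => β (piArch F ι v) * U.indicator 1 (piFinite F ι v)) v ∈ Icc (0 : ℝ) 1) ∧
      HasCompactSupport (fun v => β (piArch F ι v) * U.indicator 1 (piFinite F ι v)) ∧
      ∀ v, piArch F ι v ∈ closedBall c₀ β.rIn → piFinite F ι v ∈ U →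
        β (piArch F ι v) * U.indicator 1 (piFinite F ι v) = 1 := by
  haveI := t2Space_piFin F ι
  refine ⟨bump_mul_indicator_mem_piSchwartzBruhatReal β hUc hUo, fun v => ?_, ?_, fun v hv hU => ?_⟩
  · by_cases h : piFinite F ι v ∈ U
    · simp only [indicator_of_mem h, Pi.one_apply, mul_one]
      exact ⟨β.nonneg, β.le_one⟩
    · simp only [indicator_of_notMem h, mul_zero, mem_Icc, le_refl, zero_le_one, and_self]
  · refine (isCompact_piAdeleBox c₀ β.rOut hUc).of_isClosed_subset (isClosed_tsupport _)
      (closure_minimal (fun v hv => ?_) ((isClosed_closedBall.preimage continuous_piArch).inter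
        (hUc.isClosed.preimage continuous_piFinite)))
    rw [Function.mem_support] at hv
    constructor
    · have h1 : β (piArch F ι v) ≠ 0 := fun h => hv (by rw [h, zero_mul])
      have : piArch F ι v ∈ Function.support (β : (ι → mixedSpace F) → ℝ) := h1
      rw [β.support_eq] at this
      exact ball_subset_closedBall this
    · by_contra h
      have h' : piFinite F ι v ∉ U := h
      exact hv (by rw [indicator_of_notMem h', mul_zero])
  · rw [indicator_of_mem hU, Pi.one_apply, mul_one, β.one_of_mem_closedBall hv]

/-- **A pointwise-convergent sequence of tensor cut-offs**: there are `c_n ∈ 𝒮_ℝ(𝔸_F^ι)` with `0 ≤ c_n ≤ 1`, compact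
support and `c_n(v) = 1` eventually for every `v` — explicitly `c_n = β_n ⊗ 𝟙_{U_n}` with `β_n` the smooth bump
`= 1` on `closedBall(0, n+1)`, supported in `ball(0, n+2)`, and `U_n` a compact open exhaustion of `(𝔸_F^∞)^ι`.
[cite: Weil1965, Chap. I n° 2, Lemme 5, p. 10] -/
theorem exists_tensor_cutoff :
    ∃ (U : ℕ → Set (ι → FiniteAdeleRing (𝓞 F) F)) (β : ∀ n : ℕ, ContDiffBump (0 : ι → mixedSpace F)),
      (∀ n, IsCompact (U n)) ∧ (∀ n, IsOpen (U n)) ∧ Monotone U ∧ (∀ z, ∃ n, z ∈ U n) ∧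
      (∀ n, (β n).rIn = n + 1 ∧ (β n).rOut = n + 2) ∧
      (∀ n, (fun v => β n (piArch F ι v) * (U n).indicator 1 (piFinite F ι v)) ∈ piSchwartzBruhatReal F ι) ∧
      (∀ n v, (fun v => β n (piArch F ι v) * (U n).indicator 1 (piFinite F ι v)) v ∈ Icc (0 : ℝ) 1) ∧
      (∀ n, HasCompactSupport fun v => β n (piArch F ι v) * (U n).indicator 1 (piFinite F ι v)) ∧
      ∀ v, ∀ᶠ n in atTop, β n (piArch F ι v) * (U n).indicator 1 (piFinite F ι v) = 1 := by
  obtain ⟨U, hUc, hUo, hUmono, hUcov⟩ := exists_isCompact_isOpen_exhaustion F ι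
  set β : ∀ n : ℕ, ContDiffBump (0 : ι → mixedSpace F) := fun n =>
    ⟨n + 1, n + 2, by positivity, by linarith⟩
  refine ⟨U, β, hUc, hUo, hUmono, hUcov, fun n => ⟨rfl, rfl⟩, fun n => (tensor_cutoff_spec F ι (β n) (hUc n) (hUo n)).1,
    fun n => (tensor_cutoff_spec F ι (β n) (hUc n) (hUo n)).2.1,
    fun n => (tensor_cutoff_spec F ι (β n) (hUc n) (hUo n)).2.2.1, fun v => ?_⟩
  obtain ⟨n₁, hn₁⟩ := hUcov (piFinite F ι v)
  obtain ⟨n₂, hn₂⟩ := exists_nat_ge ‖piArch F ι v‖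
  refine eventually_atTop.mpr ⟨max n₁ n₂, fun n hn => (tensor_cutoff_spec F ι (β n) (hUc n) (hUo n)).2.2.2 v ?_
    (hUmono (le_trans (le_max_left _ _) hn) hn₁)⟩
  rw [mem_closedBall, dist_zero_right]
  have : (n₂ : ℝ) ≤ n := by exact_mod_cast (le_max_right n₁ n₂).trans hn
  show ‖piArch F ι v‖ ≤ (n : ℝ) + 1
  linarith

/-! ### §2 A positive functional continuous along cut-offs is its measure -/

section Generic

variable [MeasurableSpace (AdeleRing (𝓞 F) F)] [BorelSpace (AdeleRing (𝓞 F) F)]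
  (S : piSchwartzBruhatReal F ι →ₗ[ℝ] ℝ)
  (hS : ∀ Ψ : piSchwartzBruhatReal F ι, 0 ≤ (Ψ : (ι → AdeleRing (𝓞 F) F) → ℝ) → 0 ≤ S Ψ)

/-- **`∫ Ψ dν_S = S Ψ` for `Ψ ≥ 0` when `S` is continuous along compactly supported cut-offs**: if
`c_n ∈ 𝒮_ℝ(X)`, `0 ≤ c_n ≤ 1`, compactly supported, and `S(Ψ c_n) → S(Ψ)`, then the tightness clause of
`integral_schwartzBruhatMeasure_eq_of_tight` holds with `Ψ' = Ψ c_n`, `Θ = Ψ - Ψ c_n`.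
[cite: Weil1965, Chap. I n° 2, Lemmes 2–3, p. 7] -/
theorem integral_schwartzBruhatMeasure_eq_of_tendsto_cutoff (Ψ : piSchwartzBruhatReal F ι)
    (hΨ : 0 ≤ (Ψ : (ι → AdeleRing (𝓞 F) F) → ℝ)) (c : ℕ → (ι → AdeleRing (𝓞 F) F) → ℝ)
    (hc : ∀ n, c n ∈ piSchwartzBruhatReal F ι) (hc01 : ∀ n v, c n v ∈ Icc (0 : ℝ) 1)
    (hcs : ∀ n, HasCompactSupport (c n))
    (ht : Tendsto (fun n => S ⟨(Ψ : (ι → AdeleRing (𝓞 F) F) → ℝ) * c n,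
      mul_mem_piSchwartzBruhatReal Ψ.2 (hc n)⟩) atTop (𝓝 (S Ψ))) :
    Integrable (Ψ : (ι → AdeleRing (𝓞 F) F) → ℝ) (schwartzBruhatMeasure F ι S hS) ∧
      ∫ x, (Ψ : (ι → AdeleRing (𝓞 F) F) → ℝ) x ∂(schwartzBruhatMeasure F ι S hS) = S Ψ := by
  refine integral_schwartzBruhatMeasure_eq_of_tight F ι S hS Ψ fun ε hε => ?_
  have hlim : Tendsto (fun n => S Ψ - S ⟨(Ψ : (ι → AdeleRing (𝓞 F) F) → ℝ) * c n,
      mul_mem_piSchwartzBruhatReal Ψ.2 (hc n)⟩) atTop (𝓝 0) := by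
    have := (tendsto_const_nhds (x := S Ψ)).sub ht
    rwa [sub_self] at this
  obtain ⟨n, hn⟩ := (Metric.tendsto_atTop.mp hlim ε hε)
  have hn := hn n le_rfl
  rw [Real.dist_eq, sub_zero] at hn
  set Ψ' : piSchwartzBruhatReal F ι := ⟨(Ψ : (ι → AdeleRing (𝓞 F) F) → ℝ) * c n,
    mul_mem_piSchwartzBruhatReal Ψ.2 (hc n)⟩
  refine ⟨Ψ', Ψ - Ψ', (hcs n).mul_left, fun x => ?_, ?_⟩
  · show |(Ψ : (ι → AdeleRing (𝓞 F) F) → ℝ) x - (Ψ : (ι → AdeleRing (𝓞 F) F) → ℝ) x * c n x| ≤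
      ((Ψ - Ψ' : piSchwartzBruhatReal F ι) : (ι → AdeleRing (𝓞 F) F) → ℝ) x
    rw [Submodule.coe_sub, Pi.sub_apply]
    show |_| ≤ (Ψ : (ι → AdeleRing (𝓞 F) F) → ℝ) x - (Ψ : (ι → AdeleRing (𝓞 F) F) → ℝ) x * c n x
    have h1 := (hc01 n x).2
    have h0 : (0 : ℝ) ≤ (Ψ : (ι → AdeleRing (𝓞 F) F) → ℝ) x := hΨ x
    have hnn : 0 ≤ (Ψ : (ι → AdeleRing (𝓞 F) F) → ℝ) x - (Ψ : (ι → AdeleRing (𝓞 F) F) → ℝ) x * c n x := by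
      nlinarith
    rw [abs_of_nonneg hnn]
  · rw [map_sub]
    exact (le_abs_self _).trans hn.le

omit [MeasurableSpace (AdeleRing (𝓞 F) F)] [BorelSpace (AdeleRing (𝓞 F) F)] hS in
/-- **Two linear functionals on `𝒮_ℝ(X)` which are continuous along a sequence of compactly supported cut-offs and
agree on compactly supported functions are equal** — the step from an identity of fibre MEASURES to the identity of
FUNCTIONALS on all of `𝒮(X)`. [cite: Weil1965, Chap. I n° 2, Lemme 2, p. 7] -/
theorem linearMap_eq_of_tendsto_cutoff (S₁ S₂ : piSchwartzBruhatReal F ι →ₗ[ℝ] ℝ)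
    (c : ℕ → (ι → AdeleRing (𝓞 F) F) → ℝ) (hc : ∀ n, c n ∈ piSchwartzBruhatReal F ι)
    (hcs : ∀ n, HasCompactSupport (c n))
    (h₁ : ∀ Ψ : piSchwartzBruhatReal F ι, Tendsto (fun n => S₁ ⟨(Ψ : (ι → AdeleRing (𝓞 F) F) → ℝ) * c n,
      mul_mem_piSchwartzBruhatReal Ψ.2 (hc n)⟩) atTop (𝓝 (S₁ Ψ)))
    (h₂ : ∀ Ψ : piSchwartzBruhatReal F ι, Tendsto (fun n => S₂ ⟨(Ψ : (ι → AdeleRing (𝓞 F) F) → ℝ) * c n,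
      mul_mem_piSchwartzBruhatReal Ψ.2 (hc n)⟩) atTop (𝓝 (S₂ Ψ)))
    (heq : ∀ Ψ : piSchwartzBruhatReal F ι, HasCompactSupport (Ψ : (ι → AdeleRing (𝓞 F) F) → ℝ) → S₁ Ψ = S₂ Ψ) :
    S₁ = S₂ := by
  refine LinearMap.ext fun Ψ => tendsto_nhds_unique (h₁ Ψ) ?_
  have : (fun n => S₁ ⟨(Ψ : (ι → AdeleRing (𝓞 F) F) → ℝ) * c n, mul_mem_piSchwartzBruhatReal Ψ.2 (hc n)⟩) =
      fun n => S₂ ⟨(Ψ : (ι → AdeleRing (𝓞 F) F) → ℝ) * c n, mul_mem_piSchwartzBruhatReal Ψ.2 (hc n)⟩ :=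
    funext fun n => heq _ (hcs n).mul_left
  rw [this]
  exact h₂ Ψ

/-- **A compactly supported `Ψ ∈ 𝒮_ℝ(X)` has `S Ψ = ∫ Ψ dν_S`** (restatement of
`integral_schwartzBruhatMeasure_eq_of_coe_eq` for the test function `Ψ` itself).
[cite: Weil1965, Chap. I n° 2, Lemme 3, p. 7] -/
theorem integral_schwartzBruhatMeasure_eq_of_hasCompactSupport (Ψ : piSchwartzBruhatReal F ι)
    (hΨ : HasCompactSupport (Ψ : (ι → AdeleRing (𝓞 F) F) → ℝ)) :
    ∫ x, (Ψ : (ι → AdeleRing (𝓞 F) F) → ℝ) x ∂(schwartzBruhatMeasure F ι S hS) = S Ψ :=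
  integral_schwartzBruhatMeasure_eq_of_coe_eq F ι S hS
    ⟨⟨(Ψ : (ι → AdeleRing (𝓞 F) F) → ℝ), continuous_of_mem_piSchwartzBruhatReal Ψ.2⟩, hΨ⟩ rfl

/-- **Measures equal ⇒ functionals equal**, for positive functionals continuous along compactly supported cut-offs:
if `ν_{S₁} = ν_{S₂}` then `S₁ = S₂`. [cite: Weil1965, Chap. I n° 2, Lemme 2, p. 7] -/
theorem linearMap_eq_of_schwartzBruhatMeasure_eq (S₁ S₂ : piSchwartzBruhatReal F ι →ₗ[ℝ] ℝ)
    (hS₁ : ∀ Ψ : piSchwartzBruhatReal F ι, 0 ≤ (Ψ : (ι → AdeleRing (𝓞 F) F) → ℝ) → 0 ≤ S₁ Ψ)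
    (hS₂ : ∀ Ψ : piSchwartzBruhatReal F ι, 0 ≤ (Ψ : (ι → AdeleRing (𝓞 F) F) → ℝ) → 0 ≤ S₂ Ψ)
    (hν : schwartzBruhatMeasure F ι S₁ hS₁ = schwartzBruhatMeasure F ι S₂ hS₂)
    (c : ℕ → (ι → AdeleRing (𝓞 F) F) → ℝ) (hc : ∀ n, c n ∈ piSchwartzBruhatReal F ι)
    (hcs : ∀ n, HasCompactSupport (c n))
    (h₁ : ∀ Ψ : piSchwartzBruhatReal F ι, Tendsto (fun n => S₁ ⟨(Ψ : (ι → AdeleRing (𝓞 F) F) → ℝ) * c n,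
      mul_mem_piSchwartzBruhatReal Ψ.2 (hc n)⟩) atTop (𝓝 (S₁ Ψ)))
    (h₂ : ∀ Ψ : piSchwartzBruhatReal F ι, Tendsto (fun n => S₂ ⟨(Ψ : (ι → AdeleRing (𝓞 F) F) → ℝ) * c n,
      mul_mem_piSchwartzBruhatReal Ψ.2 (hc n)⟩) atTop (𝓝 (S₂ Ψ))) :
    S₁ = S₂ :=
  linearMap_eq_of_tendsto_cutoff F ι S₁ S₂ c hc hcs h₁ h₂ fun Ψ hΨ => by
    rw [← integral_schwartzBruhatMeasure_eq_of_hasCompactSupport F ι S₁ hS₁ Ψ hΨ, hν,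
      integral_schwartzBruhatMeasure_eq_of_hasCompactSupport F ι S₂ hS₂ Ψ hΨ]

end Generic

/-! ### §3 Continuity of `E_X` along cut-offs from a uniform majorant -/

section Eisenstein

variable [MeasurableSpace (adeleQuotient F)] [BorelSpace (adeleQuotient F)]
  [MeasurableSpace (AdeleRing (𝓞 F) F)] [BorelSpace (AdeleRing (𝓞 F) F)]
  {μ : Measure (ι → AdeleRing (𝓞 F) F)} [μ.IsAddHaarMeasure]
  {h : (ι → AdeleRing (𝓞 F) F) → AdeleRing (𝓞 F) F} (hh : Continuous h)
  (hB : ∀ Φ ∈ piSchwartzBruhat F ι, Summable fun ξ : F => ‖adelicSiegelCoeff F ι μ h Φ ξ‖)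

omit [MeasurableSpace (adeleQuotient F)] [BorelSpace (adeleQuotient F)] [μ.IsAddHaarMeasure] in
/-- **The coefficients are continuous along bounded pointwise-convergent multipliers**: if `|c_n| ≤ 1` and `c_n → 1`
pointwise then `F*_{Φ c_n}(ξ) → F*_Φ(ξ)` for every integrable `Φ` (dominated convergence, dominator `|Φ|`).
[cite: Weil1965, Chap. I n° 2, Prop. 2, p. 8] -/
theorem tendsto_adelicSiegelCoeff_mul_cutoff (hh : Continuous h) {Φ : (ι → AdeleRing (𝓞 F) F) → ℂ}
    (hΦ : Integrable Φ μ) (c : ℕ → (ι → AdeleRing (𝓞 F) F) → ℝ) (hcc : ∀ n, Continuous (c n))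
    (hc1 : ∀ n v, |c n v| ≤ 1) (hct : ∀ v, Tendsto (fun n => c n v) atTop (𝓝 1)) (ξ : F) :
    Tendsto (fun n => adelicSiegelCoeff F ι μ h (fun v => Φ v * (c n v : ℂ)) ξ) atTop
      (𝓝 (adelicSiegelCoeff F ι μ h Φ ξ)) := by
  haveI := secondCountableTopology_adeleRing (K := F)
  haveI : BorelSpace (ι → AdeleRing (𝓞 F) F) := Pi.borelSpace
  have hχ : Continuous fun x => (adeleQuotChar F ξ (QuotientAddGroup.mk (h x) : adeleQuotient F) : ℂ) :=
    (continuous_adeleQuotChar F ξ).comp ((QuotientAddGroup.continuous_mk).comp hh)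
  simp only [adelicSiegelCoeff]
  refine tendsto_integral_of_dominated_convergence (fun x => ‖Φ x‖) (fun n => ?_) hΦ.norm (fun n => ?_) ?_
  · exact (hχ.aestronglyMeasurable.mul (hΦ.1.mul (Complex.continuous_ofReal.comp (hcc n)).aestronglyMeasurable))
  · refine ae_of_all _ fun x => ?_
    rw [norm_mul, norm_mul, Complex.norm_real, Real.norm_eq_abs, norm_adeleQuotChar, one_mul]
    exact (mul_le_mul_of_nonneg_left (hc1 n x) (norm_nonneg _)).trans_eq (mul_one _)
  · refine ae_of_all _ fun x => ?_
    have := ((Complex.continuous_ofReal.tendsto 1).comp (hct x)).const_mul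
      ((adeleQuotChar F ξ (QuotientAddGroup.mk (h x) : adeleQuotient F) : ℂ) * Φ x)
    simpa only [Function.comp_def, Complex.ofReal_one, mul_one, mul_assoc] using this

omit [MeasurableSpace (adeleQuotient F)] [BorelSpace (adeleQuotient F)] in
/-- **Continuity of `E_X` along cut-offs from a uniform summable majorant** (Tannery): if `c_n ∈ 𝒮_ℝ(X)`,
`|c_n| ≤ 1`, `c_n → 1` pointwise and `‖F*_{Ψ c_n}(ξ)‖ ≤ m(ξ)` for all `n, ξ` with `Σ m < ∞` — the family-uniform
form of Weil's condition (B) on `{Ψ c_n}` — then `E_X(Ψ c_n) → E_X(Ψ)`.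
[cite: Weil1965, Chap. I n° 2, Prop. 2, p. 8] -/
theorem tendsto_adelicSiegelFunctional_cutoff (Ψ : piSchwartzBruhatReal F ι)
    (c : ℕ → (ι → AdeleRing (𝓞 F) F) → ℝ) (hc : ∀ n, c n ∈ piSchwartzBruhatReal F ι)
    (hc1 : ∀ n v, |c n v| ≤ 1) (hct : ∀ v, Tendsto (fun n => c n v) atTop (𝓝 1))
    {m : F → ℝ} (hm : Summable m)
    (hdom : ∀ n ξ, ‖adelicSiegelCoeff F ι μ h
      (fun v => (((Ψ : (ι → AdeleRing (𝓞 F) F) → ℝ) v * c n v : ℝ) : ℂ)) ξ‖ ≤ m ξ) :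
    Tendsto (fun n => adelicSiegelFunctional F ι μ h hh hB ⟨(Ψ : (ι → AdeleRing (𝓞 F) F) → ℝ) * c n,
      mul_mem_piSchwartzBruhatReal Ψ.2 (hc n)⟩) atTop (𝓝 (adelicSiegelFunctional F ι μ h hh hB Ψ)) := by
  haveI := secondCountableTopology_adeleRing (K := F)
  haveI : BorelSpace (ι → AdeleRing (𝓞 F) F) := Pi.borelSpace
  simp only [adelicSiegelFunctional_apply, Pi.mul_apply]
  refine (Complex.continuous_re.tendsto _).comp ?_
  have hΨm := Ψ.2
  rw [mem_piSchwartzBruhatReal_iff] at hΨm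
  have hΦ : Integrable (fun v => ((Ψ : (ι → AdeleRing (𝓞 F) F) → ℝ) v : ℂ)) μ :=
    integrable_of_mem_piSchwartzBruhat (ν := μ) hΨm
  have hpt := tendsto_adelicSiegelCoeff_mul_cutoff F ι hh hΦ c
    (fun n => continuous_of_mem_piSchwartzBruhatReal (hc n)) hc1 hct
  have heq : ∀ n ξ, adelicSiegelCoeff F ι μ h (fun v => (((Ψ : (ι → AdeleRing (𝓞 F) F) → ℝ) v * c n v : ℝ) : ℂ)) ξ =
      adelicSiegelCoeff F ι μ h (fun v => ((Ψ : (ι → AdeleRing (𝓞 F) F) → ℝ) v : ℂ) * (c n v : ℂ)) ξ := by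
    intro n ξ
    simp only [Complex.ofReal_mul]
  simp only [heq] at hdom ⊢
  exact tendsto_tsum_of_dominated_convergence hm hpt (Eventually.of_forall hdom)

/-- **`∫ Ψ dE_X = E_X(Ψ)` for `Ψ ≥ 0` from the uniform majorant along one cut-off sequence.**
[cite: Weil1965, Chap. IV n° 41, (35) p. 59] -/
theorem integral_adelicSiegelMeasure_eq_of_dominated (Ψ : piSchwartzBruhatReal F ι)
    (hΨ : 0 ≤ (Ψ : (ι → AdeleRing (𝓞 F) F) → ℝ))
    (c : ℕ → (ι → AdeleRing (𝓞 F) F) → ℝ) (hc : ∀ n, c n ∈ piSchwartzBruhatReal F ι)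
    (hc01 : ∀ n v, c n v ∈ Icc (0 : ℝ) 1) (hcs : ∀ n, HasCompactSupport (c n))
    (hct : ∀ v, Tendsto (fun n => c n v) atTop (𝓝 1)) {m : F → ℝ} (hm : Summable m)
    (hdom : ∀ n ξ, ‖adelicSiegelCoeff F ι μ h
      (fun v => (((Ψ : (ι → AdeleRing (𝓞 F) F) → ℝ) v * c n v : ℝ) : ℂ)) ξ‖ ≤ m ξ) :
    Integrable (Ψ : (ι → AdeleRing (𝓞 F) F) → ℝ) (adelicSiegelMeasure F ι μ h hh hB) ∧
      ∫ x, (Ψ : (ι → AdeleRing (𝓞 F) F) → ℝ) x ∂(adelicSiegelMeasure F ι μ h hh hB) =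
        adelicSiegelFunctional F ι μ h hh hB Ψ :=
  integral_schwartzBruhatMeasure_eq_of_tendsto_cutoff F ι _ _ Ψ hΨ c hc hc01 hcs
    (tendsto_adelicSiegelFunctional_cutoff F ι hh hB Ψ c hc (fun n v => by
      rw [abs_le]
      exact ⟨by linarith [(hc01 n v).1], (hc01 n v).2⟩) hct hm hdom)

end Eisenstein

/-! ### §4 (ED. 2) Dilation cut-offs: `β_n(x) = β_0(x/(n+1))` -/

section Dilate

/-- **Dilation cut-offs** (ED. 2): the tensor cut-off sequence of `exists_tensor_cutoff` with the archimedean bumps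
chosen as DILATES of one profile, `β_n(y) = β_0((n+1)⁻¹ y)` (`rIn = n+1`, `rOut = 2(n+1)`, ratio fixed) — so that the
archimedean Schwartz seminorms of `Φ_∞ · β_n` are bounded uniformly in `n` by the chain rule (the uniformity that
Weil's "convergence uniforme sur toute partie compacte de `𝒮(X)`" asks of the family `{Ψ c_n}`).
[cite: Weil1965, Chap. I n° 2, Lemme 5, p. 10] -/
theorem exists_tensor_cutoff_dilate :
    ∃ (U : ℕ → Set (ι → FiniteAdeleRing (𝓞 F) F)) (β : ∀ n : ℕ, ContDiffBump (0 : ι → mixedSpace F)),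
      (∀ n, IsCompact (U n)) ∧ (∀ n, IsOpen (U n)) ∧ Monotone U ∧ (∀ z, ∃ n, z ∈ U n) ∧
      (∀ n, (β n).rIn = n + 1 ∧ (β n).rOut = 2 * (n + 1)) ∧
      (∀ n (y : ι → mixedSpace F), β n y = β 0 (((n : ℝ) + 1)⁻¹ • y)) ∧
      (∀ n, (fun v => β n (piArch F ι v) * (U n).indicator 1 (piFinite F ι v)) ∈ piSchwartzBruhatReal F ι) ∧
      (∀ n v, (fun v => β n (piArch F ι v) * (U n).indicator 1 (piFinite F ι v)) v ∈ Icc (0 : ℝ) 1) ∧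
      (∀ n, HasCompactSupport fun v => β n (piArch F ι v) * (U n).indicator 1 (piFinite F ι v)) ∧
      ∀ v, ∀ᶠ n in atTop, β n (piArch F ι v) * (U n).indicator 1 (piFinite F ι v) = 1 := by
  obtain ⟨U, hUc, hUo, hUmono, hUcov⟩ := exists_isCompact_isOpen_exhaustion F ι
  set β : ∀ n : ℕ, ContDiffBump (0 : ι → mixedSpace F) := fun n =>
    ⟨n + 1, 2 * (n + 1), by positivity, by linarith⟩
  have hratio : ∀ n, (β n).rOut / (β n).rIn = 2 := fun n => by
    show (2 * ((n : ℝ) + 1)) / ((n : ℝ) + 1) = 2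
    rw [mul_div_assoc, div_self (by positivity), mul_one]
  refine ⟨U, β, hUc, hUo, hUmono, hUcov, fun n => ⟨rfl, rfl⟩, fun n y => ?_,
    fun n => (tensor_cutoff_spec F ι (β n) (hUc n) (hUo n)).1,
    fun n => (tensor_cutoff_spec F ι (β n) (hUc n) (hUo n)).2.1,
    fun n => (tensor_cutoff_spec F ι (β n) (hUc n) (hUo n)).2.2.1, fun v => ?_⟩
  · rw [(β n).apply, (β 0).apply, hratio n, hratio 0, sub_zero, sub_zero]
    congr 1
    show ((n : ℝ) + 1)⁻¹ • y = (((0 : ℕ) : ℝ) + 1)⁻¹ • (((n : ℝ) + 1)⁻¹ • y)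
    rw [Nat.cast_zero, zero_add, inv_one, one_smul]
  · obtain ⟨n₁, hn₁⟩ := hUcov (piFinite F ι v)
    obtain ⟨n₂, hn₂⟩ := exists_nat_ge ‖piArch F ι v‖
    refine eventually_atTop.mpr ⟨max n₁ n₂, fun n hn => (tensor_cutoff_spec F ι (β n) (hUc n) (hUo n)).2.2.2 v ?_
      (hUmono (le_trans (le_max_left _ _) hn) hn₁)⟩
    rw [mem_closedBall, dist_zero_right]
    have : (n₂ : ℝ) ≤ n := by exact_mod_cast (le_max_right n₁ n₂).trans hn
    show ‖piArch F ι v‖ ≤ (n : ℝ) + 1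
    linarith

omit [Fintype ι] in
/-- **Finite parts are eventually untouched by the cut-offs**: a compactly supported `Φ_f` on `(𝔸_F^∞)^ι` satisfies
`Φ_f · 𝟙_{U_n} = Φ_f` for all large `n` whenever `U_n` is an increasing open cover — so along the cut-off family only
FINITELY MANY finite components occur. [cite: Weil1965, Chap. I n° 2, Lemme 5, p. 10] -/
theorem eventually_mul_indicator_eq_self {U : ℕ → Set (ι → FiniteAdeleRing (𝓞 F) F)} (hUo : ∀ n, IsOpen (U n))
    (hUmono : Monotone U) (hUcov : ∀ z, ∃ n, z ∈ U n) {E : Type*} [MulZeroOneClass E] [TopologicalSpace E]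
    (Φ : (ι → FiniteAdeleRing (𝓞 F) F) → E) (hΦ : HasCompactSupport Φ) :
    ∀ᶠ n in atTop, (fun z => Φ z * (U n).indicator 1 z) = Φ := by
  -- the compact support is covered by one `U n`
  obtain ⟨t, ht⟩ := hΦ.elim_finite_subcover U hUo fun z _ => mem_iUnion.mpr (hUcov z)
  obtain ⟨n₀, hn₀⟩ : ∃ n₀, ∀ k ∈ t, k ≤ n₀ := ⟨t.sup id, fun k hk => Finset.le_sup (f := id) hk⟩
  refine eventually_atTop.mpr ⟨n₀, fun n hn => funext fun z => ?_⟩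
  by_cases hz : z ∈ tsupport Φ
  · obtain ⟨k, hkt, hk⟩ : ∃ k ∈ t, z ∈ U k := by simpa only [mem_iUnion, exists_prop] using ht hz
    rw [indicator_of_mem (hUmono ((hn₀ k hkt).trans hn) hk), Pi.one_apply, mul_one]
  · rw [image_eq_zero_of_notMem_tsupport hz, zero_mul]

end Dilate

end Literature.NumberTheory.Weil1965
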